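import Summits.ResolutionOfSingularities.ResolutionOfSingularities.Theorems.FrobeniusClosingSteerArithTransportFineKernel
import Mathlib.Algebra.MvPolynomial.PDeriv
import HarnessLib

/-!
# K-β0(b) fine words — the `e = 2` clause ACROSS THE VISIT: stability of «`Ψ̄` is not `c·ℓ^d`» under the residue-field extension `κ_j → κ_{j′}`
  when `d` is a unit of the residue field (here: `d` odd, characteristic `2`) (res-L0-w41-plan-1 RULINGs 318 (d) / 322 (ii); def-free)

OURS (campaign `res-hironaka`, rung L ★L-G4, slot W4.1 · crux `Steer` (stmt-ResolutionOfSingularities-16345) · K-β0(b)). Candidates, not facts; nothing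
here is a statement of H. Hironakaʼs manuscript [claim: Hironaka2017, status: under-review]; AI-written, AI review is weaker than expert review.

Companion of `…ArithTransportFineKernel` (p580900). In (F-AB)/(F-BB) v2 the form at the landing stage is `Ψ′ := map (R j ↪ R j′) Ψ` (up to the unit
`W⁻²`, `ArithTransportFine.e2_C_mul`), and the `e = 2` clause of `BinaryBConeE2At … j′` is read over `κ_{j′} = ResidueField (R j′)`, an extension of
`κ_j` which at an on-line landing point may be PROPER (the fourth chart coordinate can have a non-rational residue). For `d` invertible in the
residue field the clause is stable: if `Ψ̄ = c·(aX + bY)^d` over the big field with `a ≠ 0`, then `γ := Ψ̄(1,0) = c·a^d` and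
`(∂Ψ̄/∂Y)(1,0) = γ·d·(b/a)` lie in the small field, so `b/a` does, and `Ψ̄ = γ·(X + (b/a)Y)^d` over the small field (injectivity of `map`); `a = 0`
is the monomial case `c·b^d·Y^d`. (For `d` divisible by the characteristic the clause is NOT stable — `X² + aY² = (X + √a·Y)²` — irrelevant here:
`d` is odd.)
* `hom_eval` — `φ (Ψ(g)) = (map φ Ψ)(φ ∘ g)`.
* **`e2_of_map`** — fields `κ → κ′`, `(d : κ′) ≠ 0`: `¬ (∃ a b c, Ψ = C c·(C a·X 0 + C b·X 1)^d)` ⇒ the same for `map φ Ψ` over `κ′`.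
* **`e2_map_of_isLocalHom`** — local-ring currency: a local homomorphism `ι : A →+* B` of local rings, `(d : ResidueField B) ≠ 0`: the `e = 2`
  clause for `Ψ` over `ResidueField A` gives it for `map ι Ψ` over `ResidueField B` (`ResidueField.map_comp_residue`). With `ι :=` the inclusion
  `R j → R j′` of a steered run (local by domination) and `d` odd this is the `hE` input of `ArithTransportFine.binaryBConeE2At_of_presentation` at `j′`.
[cite: Matsumura1987, Thm. 14.2] [folklore]
-/

noncomputable section

-- `Summit.<S>.<S>.…` duplicates the summit name by design (single-problem summit).
set_option linter.dupNamespace false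

open IsLocalRing MvPolynomial

namespace Summit.ResolutionOfSingularities.ResolutionOfSingularities.Theorems.SwitchingDichotomy.ArithTransportFine

section Residue

variable {κ κ' : Type} [Field κ] [Field κ']

/-- `φ (Ψ(g)) = (map φ Ψ)(φ ∘ g)` for a ring homomorphism of fields `φ`. [folklore] -/
theorem hom_eval (φ : κ →+* κ') (g : Fin 2 → κ) (p : MvPolynomial (Fin 2) κ) :
    φ (eval g p) = eval (φ ∘ g) (MvPolynomial.map φ p) := by
  rw [eval_map]
  exact (eval₂_comp_left φ (RingHom.id κ) g p).trans (by rw [RingHom.comp_id])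

/-- **The `e = 2` clause is stable under field extension when `d` is a unit**: `φ : κ →+* κ′`, `(d : κ′) ≠ 0`; if `Ψ` is not
`c·(aX + bY)^d` over `κ`, then `map φ Ψ` is not `c·(aX + bY)^d` over `κ′`. (`a = 0`: monomial `c b^d·Y^d`, read the coefficient; `a ≠ 0`:
`γ = Ψ̄(1,0)` and `γ·d·(b/a) = (∂₁Ψ̄)(1,0)` are values of `φ`, so `b/a` is, and `map φ` is injective.) [folklore] -/
theorem e2_of_map (φ : κ →+* κ') {d : ℕ} (hd : (d : κ') ≠ 0)
    {Ψ : MvPolynomial (Fin 2) κ} (hE : ¬ ∃ a b c : κ, Ψ = C c * (C a * X 0 + C b * X 1) ^ d) :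
    ¬ ∃ a b c : κ', MvPolynomial.map φ Ψ = C c * (C a * X 0 + C b * X 1) ^ d := by
  classical
  rintro ⟨a, b, c, h⟩
  have hinj := MvPolynomial.map_injective (σ := Fin 2) φ φ.injective
  by_cases ha : a = 0
  · -- `P = C (c b^d) · X₁^d`
    have h1 : MvPolynomial.map φ Ψ = C (c * b ^ d) * X 1 ^ d := by
      rw [h, ha, C_0, zero_mul, zero_add, mul_pow, ← C_pow, ← mul_assoc, ← C_mul]
    have hγ : φ (coeff (Finsupp.single 1 d) Ψ) = c * b ^ d := by
      have h2 := congrArg (coeff (Finsupp.single 1 d)) h1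
      rwa [coeff_map, coeff_C_mul, coeff_X_pow, if_pos rfl, mul_one] at h2
    refine hE ⟨0, 1, coeff (Finsupp.single 1 d) Ψ, hinj ?_⟩
    rw [h1]
    simp only [_root_.map_mul (MvPolynomial.map φ), _root_.map_pow (MvPolynomial.map φ), map_C, map_X, hγ, _root_.map_zero,
      _root_.map_one, zero_mul, zero_add, one_mul]
  · -- `P = C γ · (X₀ + C β X₁)^d`, `γ = c a^d`, `β = b / a`
    have hc : c ≠ 0 := by
      rintro rfl
      rw [C_0, zero_mul] at h
      refine hE ⟨0, 0, 0, ?_⟩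
      rw [C_0, zero_mul]
      exact hinj (by rw [h, _root_.map_zero])
    set γ : κ' := c * a ^ d with hγdef
    set β : κ' := b / a with hβdef
    set L : MvPolynomial (Fin 2) κ' := X 0 + C β * X 1 with hL
    have hγ0 : γ ≠ 0 := mul_ne_zero hc (pow_ne_zero _ ha)
    have h1 : MvPolynomial.map φ Ψ = C γ * L ^ d := by
      have e : C a * X 0 + C b * X 1 = C a * L := by
        rw [hL, mul_add, ← mul_assoc, ← C_mul, hβdef, mul_div_cancel₀ _ ha]
      rw [h, e, mul_pow, ← C_pow, ← mul_assoc, ← C_mul]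
    -- evaluations at `(1, 0)`
    have hL1 : eval ![(1 : κ'), 0] L = 1 := by simp [hL]
    have hφ1 : (φ ∘ ![(1 : κ), 0]) = ![(1 : κ'), 0] := by
      funext i; fin_cases i <;> simp
    have e0 : φ (eval ![(1 : κ), 0] Ψ) = γ := by
      rw [hom_eval, hφ1, h1, _root_.map_mul, eval_C, _root_.map_pow, hL1, one_pow, mul_one]
    have hdL : pderiv 1 L = C β := by
      simp [hL, pderiv_X]
    have e1 : φ (eval ![(1 : κ), 0] (pderiv 1 Ψ)) = γ * ((d : κ') * β) := by
      rw [hom_eval, hφ1, ← pderiv_map, h1, pderiv_C_mul, pderiv_pow, hdL, _root_.map_mul, eval_C]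
      congr 1
      rw [_root_.map_mul, _root_.map_mul, _root_.map_pow, hL1, one_pow, mul_one, eval_C, map_natCast]
    -- `β`, `γ` are in the image of `φ`
    set γ₀ : κ := eval ![(1 : κ), 0] Ψ with hγ₀
    set δ₀ : κ := eval ![(1 : κ), 0] (pderiv 1 Ψ) with hδ₀
    have hd0 : (d : κ) ≠ 0 := fun h0 => hd (by rw [← map_natCast φ d, h0, _root_.map_zero])
    have hγ00 : γ₀ ≠ 0 := fun h0 => hγ0 (by rw [← e0, h0, _root_.map_zero])
    set β₀ : κ := δ₀ / ((d : κ) * γ₀) with hβ₀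
    have hβ : φ β₀ = β := by
      rw [hβ₀, map_div₀, _root_.map_mul, map_natCast, e1, e0]
      field_simp
    refine hE ⟨1, β₀, γ₀, hinj ?_⟩
    rw [h1]
    simp only [_root_.map_mul (MvPolynomial.map φ), _root_.map_pow (MvPolynomial.map φ), _root_.map_add (MvPolynomial.map φ),
      map_C, map_X, e0, hβ, _root_.map_one, one_mul, hL]

/-- **Local-ring currency**: for a local homomorphism `ι : A →+* B` of local rings and `(d : ResidueField B) ≠ 0`, the `e = 2` clause for `Ψ`
over `ResidueField A` gives the `e = 2` clause for `map ι Ψ` over `ResidueField B` (`map (residue B) (map ι Ψ) = map (ResidueField.map ι)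
(map (residue A) Ψ)`). [folklore] -/
theorem e2_map_of_isLocalHom {A B : Type} [CommRing A] [CommRing B] [IsLocalRing A] [IsLocalRing B] (ι : A →+* B) [IsLocalHom ι]
    {d : ℕ} (hd : (d : ResidueField B) ≠ 0) {Ψ : MvPolynomial (Fin 2) A}
    (hE : ¬ ∃ a b c : ResidueField A, MvPolynomial.map (residue A) Ψ = C c * (C a * X 0 + C b * X 1) ^ d) :
    ¬ ∃ a b c : ResidueField B, MvPolynomial.map (residue B) (MvPolynomial.map ι Ψ) = C c * (C a * X 0 + C b * X 1) ^ d := by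
  have e : MvPolynomial.map (residue B) (MvPolynomial.map ι Ψ) =
      MvPolynomial.map (ResidueField.map ι) (MvPolynomial.map (residue A) Ψ) := by
    rw [map_map, map_map, ← ResidueField.map_comp_residue]
  rw [e]
  exact e2_of_map (ResidueField.map ι) hd hE

end Residue

end Summit.ResolutionOfSingularities.ResolutionOfSingularities.Theorems.SwitchingDichotomy.ArithTransportFine
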